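import Summits.CriticalPhenomena.PercolationContinuityZ3.Theorems.PercNearOneGluingNoHeavyLowerTailKnQuestion8CoefficientwiseCoreClassDomLeafClusters
import HarnessLib

/-!
# Boundary inequality on bundles, I: frozen-fibre Harris flows and the two-fibre-systems count (abstract core)

Support file (`--supports stmt-CriticalPhenomena-4575`, closed), prover `prim-cplus-coupling` (gen 46).  No definitions, no notations, no named facts,
no sorries; standard axioms.  Memo `prim-cplus-coupling/A5-COUPLING-gen45.md` §3.9 (THEOREM BI), steps (a), (c), (d) in abstract form.

ABSTRACT SETTING.  Colourings are subsets `ξ ⊆ E'` of a finite index set (in the application `E' = P ∪ Q`, the two mixed threads of a bundle, all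
other threads being blue at SOURCES and red at TARGETS).  A FROZEN FIBRE is a cylinder `{ξ ⊆ E' : ξ ∩ Φ = π}` (`π ⊆ Φ ⊆ E'`); the free coordinates are
`E' ∖ Φ` and the PARTNER of `ξ` in the fibre is `ρ(ξ) = π ∪ ((E' ∖ Φ) ∖ ξ)` (frozen part kept, free part complemented).
* `Coefficientwise.card_filter_fibre_eq` — a fibre is a copy of the cube `2^{E' ∖ Φ}` (`γ ↦ π ∪ γ`).
* `Coefficientwise.frozen_fibre_flow` — ONE PREFIX-FROZEN FLOW (memo §3.9 (a), counting part): for `Vp, hro` increasing and `kbo, N` decreasing,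
  `#{ξ in the fibre : Vp ξ ∧ N ξ ∧ hro ξ ∧ kbo ξ} ≤ #{ξ in the fibre : Vp ξ ∧ hro ξ ∧ kbo ρ(ξ) ∧ N ρ(ξ)}` (two-colouring Harris
  `sum_mul_sdiff_le_sum_mul` on the free coordinates; the right-hand side are the LANDINGS, with partner `ρ`).
* `Coefficientwise.two_fibre_systems_count` — memo §3.9 (c)+(d), abstract: if the type-1 sources are covered by a system of pairwise disjoint fibres
  each carrying such a flow whose landings are type-1 TARGETS, likewise for type 2, and every common landing of the two systems is a JOIN, then
  `#src₁ + #src₂ ≤ #(T₁ ∪ T₂) + #joins` (`#Λ₁ + #Λ₂ = #(Λ₁ ∪ Λ₂) + #(Λ₁ ∩ Λ₂)`).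
The prefix structure, the choice of the fibre systems and the cluster-trace transfer are in the sequel files (…KernelMixBoundaryPrefixFlows,
…KernelMixBundleBoundary*).  [cite: KozmaNitzan2024, Questions 8–9 (§5.5 p. 36) (context); Harris 1960]
-/

namespace Summit.CriticalPhenomena.PercolationContinuityZ3.Theorems

open Finset

namespace Coefficientwise

variable {ι : Type*}

open Classical in
/-- **A frozen fibre is a cube.**  For `π ⊆ Φ ⊆ E'` and any predicate `R`, the colourings `ξ ⊆ E'` with `ξ ∩ Φ = π` and `R ξ` are in bijection
(`ξ ↦ ξ ∖ Φ`, `γ ↦ π ∪ γ`) with the `γ ⊆ E' ∖ Φ` with `R (π ∪ γ)`. [folklore] -/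
theorem card_filter_fibre_eq (E' Φ π : Finset ι) (hπΦ : π ⊆ Φ) (hΦE : Φ ⊆ E') (R : Finset ι → Prop) :
    ((E'.powerset).filter (fun ξ => ξ ∩ Φ = π ∧ R ξ)).card = (((E' \ Φ).powerset).filter (fun γ => R (π ∪ γ))).card := by
  refine Finset.card_nbij' (fun ξ => ξ \ Φ) (fun γ => π ∪ γ) ?_ ?_ ?_ ?_
  · intro ξ hξ
    rw [Finset.mem_coe, Finset.mem_filter, Finset.mem_powerset] at hξ
    obtain ⟨hξE, hξΦ, hR⟩ := hξ
    rw [Finset.mem_coe, Finset.mem_filter, Finset.mem_powerset]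
    refine ⟨Finset.sdiff_subset_sdiff hξE (le_refl Φ), ?_⟩
    have : π ∪ ξ \ Φ = ξ := by rw [← hξΦ]; exact sup_inf_sdiff ξ Φ
    rw [this]; exact hR
  · intro γ hγ
    rw [Finset.mem_coe, Finset.mem_filter, Finset.mem_powerset] at hγ
    obtain ⟨hγD, hR⟩ := hγ
    rw [Finset.mem_coe, Finset.mem_filter, Finset.mem_powerset]
    refine ⟨Finset.union_subset (hπΦ.trans hΦE) (hγD.trans Finset.sdiff_subset), ?_, hR⟩
    rw [Finset.union_inter_distrib_right, Finset.inter_eq_left.mpr hπΦ]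
    have : γ ∩ Φ = ∅ := Finset.disjoint_iff_inter_eq_empty.mp (Finset.disjoint_of_subset_left hγD Finset.sdiff_disjoint)
    rw [this, Finset.union_empty]
  · intro ξ hξ
    rw [Finset.mem_coe, Finset.mem_filter, Finset.mem_powerset] at hξ
    obtain ⟨_, hξΦ, _⟩ := hξ
    show π ∪ ξ \ Φ = ξ
    rw [← hξΦ]; exact sup_inf_sdiff ξ Φ
  · intro γ hγ
    rw [Finset.mem_coe, Finset.mem_filter, Finset.mem_powerset] at hγ
    obtain ⟨hγD, _⟩ := hγ
    show (π ∪ γ) \ Φ = γ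
    rw [Finset.union_sdiff_distrib, Finset.sdiff_eq_empty_iff_subset.mpr hπΦ, Finset.empty_union]
    exact Finset.sdiff_eq_self_of_disjoint (Finset.disjoint_of_subset_left hγD Finset.sdiff_disjoint)

open Classical in
/-- **One frozen-fibre flow (abstract Harris step).**  `π ⊆ Φ ⊆ E'`; `Vp, hro` increasing, `kbo, N` decreasing predicates on colourings.  In the fibre
`{ξ ⊆ E' : ξ ∩ Φ = π}` the SOURCES `Vp ∧ N ∧ hro ∧ kbo` are at most as many as the LANDINGS: `ξ` with `Vp ξ ∧ hro ξ` whose partner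
`ρ = π ∪ ((E' ∖ Φ) ∖ ξ)` satisfies `kbo ρ ∧ N ρ` (two-colouring Harris on the free coordinates `E' ∖ Φ`).  Memo gen 45 §3.9 (a), counting part.
[cite: KozmaNitzan2024, Questions 8–9 (§5.5 p. 36) (context); Harris 1960] -/
theorem frozen_fibre_flow (E' Φ π : Finset ι) (hπΦ : π ⊆ Φ) (hΦE : Φ ⊆ E')
    (Vp hro kbo N : Finset ι → Prop)
    (V_mono : ∀ s t : Finset ι, s ⊆ t → Vp s → Vp t) (hro_mono : ∀ s t : Finset ι, s ⊆ t → hro s → hro t)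
    (kbo_anti : ∀ s t : Finset ι, s ⊆ t → kbo t → kbo s) (N_anti : ∀ s t : Finset ι, s ⊆ t → N t → N s) :
    ((E'.powerset).filter (fun ξ => ξ ∩ Φ = π ∧ (Vp ξ ∧ N ξ ∧ hro ξ ∧ kbo ξ))).card ≤
      ((E'.powerset).filter (fun ξ => ξ ∩ Φ = π ∧
        (Vp ξ ∧ hro ξ ∧ kbo (π ∪ ((E' \ Φ) \ ξ)) ∧ N (π ∪ ((E' \ Φ) \ ξ))))).card := by
  have e1 : ((E'.powerset).filter (fun ξ => ξ ∩ Φ = π ∧ (Vp ξ ∧ N ξ ∧ hro ξ ∧ kbo ξ))).card =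
      (((E' \ Φ).powerset).filter (fun γ => Vp (π ∪ γ) ∧ N (π ∪ γ) ∧ hro (π ∪ γ) ∧ kbo (π ∪ γ))).card := by
    convert card_filter_fibre_eq E' Φ π hπΦ hΦE (fun ξ => Vp ξ ∧ N ξ ∧ hro ξ ∧ kbo ξ)
  have e2 : ((E'.powerset).filter (fun ξ => ξ ∩ Φ = π ∧
        (Vp ξ ∧ hro ξ ∧ kbo (π ∪ ((E' \ Φ) \ ξ)) ∧ N (π ∪ ((E' \ Φ) \ ξ))))).card =
      (((E' \ Φ).powerset).filter (fun γ => Vp (π ∪ γ) ∧ hro (π ∪ γ) ∧ kbo (π ∪ ((E' \ Φ) \ (π ∪ γ))) ∧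
        N (π ∪ ((E' \ Φ) \ (π ∪ γ))))).card := by
    convert card_filter_fibre_eq E' Φ π hπΦ hΦE (fun ξ => Vp ξ ∧ hro ξ ∧ kbo (π ∪ ((E' \ Φ) \ ξ)) ∧ N (π ∪ ((E' \ Φ) \ ξ)))
  rw [e1, e2]
  set D : Finset ι := E' \ Φ with hD
  have hπD : Disjoint π D := by
    rw [hD]; exact Finset.disjoint_of_subset_left hπΦ Finset.disjoint_sdiff
  have sd : ∀ γ : Finset ι, D \ (π ∪ γ) = D \ γ := by
    intro γ
    ext x
    simp only [Finset.mem_sdiff, Finset.mem_union, not_or]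
    constructor
    · rintro ⟨hx, -, hγ⟩; exact ⟨hx, hγ⟩
    · rintro ⟨hx, hγ⟩; exact ⟨hx, fun hπ => Finset.disjoint_left.mp hπD hπ hx, hγ⟩
  -- pass to real sums
  suffices h : ((((D.powerset).filter (fun γ => Vp (π ∪ γ) ∧ N (π ∪ γ) ∧ hro (π ∪ γ) ∧ kbo (π ∪ γ))).card : ℕ) : ℝ) ≤
      ((((D.powerset).filter (fun γ => Vp (π ∪ γ) ∧ hro (π ∪ γ) ∧ kbo (π ∪ (D \ (π ∪ γ))) ∧ N (π ∪ (D \ (π ∪ γ))))).card : ℕ) : ℝ) by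
    exact_mod_cast h
  rw [Finset.natCast_card_filter, Finset.natCast_card_filter]
  set F : Finset ι → ℝ := fun γ => if Vp (π ∪ γ) ∧ hro (π ∪ γ) then 1 else 0 with hF
  set G : Finset ι → ℝ := fun γ => if kbo (π ∪ (D \ γ)) ∧ N (π ∪ (D \ γ)) then 1 else 0 with hG
  have mF : Monotone F := by
    intro s t hst
    simp only [hF]
    by_cases h1 : Vp (π ∪ s) ∧ hro (π ∪ s)
    · have hsub : π ∪ s ⊆ π ∪ t := Finset.union_subset_union (le_refl π) hst
      rw [if_pos h1, if_pos ⟨V_mono _ _ hsub h1.1, hro_mono _ _ hsub h1.2⟩]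
    · rw [if_neg h1]; split_ifs <;> norm_num
  have mG : Monotone G := by
    intro s t hst
    simp only [hG]
    by_cases h1 : kbo (π ∪ (D \ s)) ∧ N (π ∪ (D \ s))
    · have hsub : π ∪ (D \ t) ⊆ π ∪ (D \ s) := Finset.union_subset_union (le_refl π) (Finset.sdiff_subset_sdiff (le_refl D) hst)
      rw [if_pos h1, if_pos ⟨kbo_anti _ _ hsub h1.1, N_anti _ _ hsub h1.2⟩]
    · rw [if_neg h1]; split_ifs <;> norm_num
  have key := sum_mul_sdiff_le_sum_mul D F G mF mG
  have lhs : ∀ γ ∈ D.powerset, (if Vp (π ∪ γ) ∧ N (π ∪ γ) ∧ hro (π ∪ γ) ∧ kbo (π ∪ γ) then (1 : ℝ) else 0) = F γ * G (D \ γ) := by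
    intro γ hγ
    have hγD : γ ⊆ D := Finset.mem_powerset.mp hγ
    simp only [hF, hG]
    rw [Finset.sdiff_sdiff_eq_self hγD]
    by_cases h1 : Vp (π ∪ γ) ∧ hro (π ∪ γ)
    · rw [if_pos h1, one_mul]
      by_cases h2 : kbo (π ∪ γ) ∧ N (π ∪ γ)
      · rw [if_pos h2, if_pos ⟨h1.1, h2.2, h1.2, h2.1⟩]
      · rw [if_neg h2, if_neg (fun h3 => h2 ⟨h3.2.2.2, h3.2.1⟩)]
    · rw [if_neg h1, zero_mul, if_neg (fun h3 => h1 ⟨h3.1, h3.2.2.1⟩)]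
  have rhs : ∀ γ ∈ D.powerset, (if Vp (π ∪ γ) ∧ hro (π ∪ γ) ∧ kbo (π ∪ (D \ (π ∪ γ))) ∧ N (π ∪ (D \ (π ∪ γ))) then (1 : ℝ) else 0)
      = F γ * G γ := by
    intro γ _
    simp only [hF, hG]
    rw [sd γ]
    by_cases h1 : Vp (π ∪ γ) ∧ hro (π ∪ γ)
    · rw [if_pos h1, one_mul]
      by_cases h2 : kbo (π ∪ (D \ γ)) ∧ N (π ∪ (D \ γ))
      · rw [if_pos h2, if_pos ⟨h1.1, h1.2, h2.1, h2.2⟩]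
      · rw [if_neg h2, if_neg (fun h3 => h2 ⟨h3.2.2.1, h3.2.2.2⟩)]
    · rw [if_neg h1, zero_mul, if_neg (fun h3 => h1 ⟨h3.1, h3.2.1⟩)]
  rw [Finset.sum_congr rfl lhs, Finset.sum_congr rfl rhs]
  exact key

open Classical in
/-- **Two fibre systems with self-paying collisions (abstract assembly).**  Colourings `ξ ⊆ E'`; two source predicates `src₁, src₂`, target predicates
`T₁, T₂`, a join predicate `Jn`; fibres `fib j` and landing predicates `landᵢ j` indexed by `j : ℕ × ℕ`, used through the finite systems `J₁, J₂`.
If (i) in every fibre of `Jᵢ` the type-`i` sources are at most the type-`i` landings, (ii) every type-`i` source lies in some fibre of `Jᵢ`, (iii) the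
fibres of each system are pairwise disjoint, (iv) landings are targets of their type, and (v) a common landing of the two systems is a join, then
`#src₁ + #src₂ ≤ #(T₁ ∨ T₂) + #Jn`.  Proof: `#srcᵢ ≤ #Λᵢ` (`Λᵢ` = all type-`i` landings) and `#Λ₁ + #Λ₂ = #(Λ₁ ∪ Λ₂) + #(Λ₁ ∩ Λ₂)`.  Memo gen 45
§3.9 (c), (d).  [cite: KozmaNitzan2024, Questions 8–9 (§5.5 p. 36) (context)] -/
theorem two_fibre_systems_count (E' : Finset ι) (J₁ J₂ : Finset (ℕ × ℕ))
    (src₁ src₂ T₁ T₂ Jn : Finset ι → Prop) (fib : ℕ × ℕ → Finset ι → Prop) (land₁ land₂ : ℕ × ℕ → Finset ι → Prop)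
    (h₁ : ∀ j ∈ J₁, ((E'.powerset).filter (fun ξ => fib j ξ ∧ src₁ ξ)).card ≤ ((E'.powerset).filter (fun ξ => fib j ξ ∧ land₁ j ξ)).card)
    (h₂ : ∀ j ∈ J₂, ((E'.powerset).filter (fun ξ => fib j ξ ∧ src₂ ξ)).card ≤ ((E'.powerset).filter (fun ξ => fib j ξ ∧ land₂ j ξ)).card)
    (cover₁ : ∀ ξ, ξ ⊆ E' → src₁ ξ → ∃ j ∈ J₁, fib j ξ) (cover₂ : ∀ ξ, ξ ⊆ E' → src₂ ξ → ∃ j ∈ J₂, fib j ξ)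
    (disj₁ : ∀ j ∈ J₁, ∀ j' ∈ J₁, j ≠ j' → ∀ ξ, fib j ξ → fib j' ξ → False)
    (disj₂ : ∀ j ∈ J₂, ∀ j' ∈ J₂, j ≠ j' → ∀ ξ, fib j ξ → fib j' ξ → False)
    (tgt₁ : ∀ j ∈ J₁, ∀ ξ, ξ ⊆ E' → fib j ξ → land₁ j ξ → T₁ ξ) (tgt₂ : ∀ j ∈ J₂, ∀ ξ, ξ ⊆ E' → fib j ξ → land₂ j ξ → T₂ ξ)
    (join : ∀ ξ, ξ ⊆ E' → ∀ j ∈ J₁, ∀ j' ∈ J₂, fib j ξ → land₁ j ξ → fib j' ξ → land₂ j' ξ → Jn ξ) :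
    ((E'.powerset).filter (fun ξ => src₁ ξ)).card + ((E'.powerset).filter (fun ξ => src₂ ξ)).card ≤
      ((E'.powerset).filter (fun ξ => T₁ ξ ∨ T₂ ξ)).card + ((E'.powerset).filter (fun ξ => Jn ξ)).card := by
  set Λ₁ : Finset (Finset ι) := J₁.biUnion (fun j => (E'.powerset).filter (fun ξ => fib j ξ ∧ land₁ j ξ)) with hΛ₁
  set Λ₂ : Finset (Finset ι) := J₂.biUnion (fun j => (E'.powerset).filter (fun ξ => fib j ξ ∧ land₂ j ξ)) with hΛ₂
  -- sources are at most landings, type by type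
  have bound : ∀ (J : Finset (ℕ × ℕ)) (src : Finset ι → Prop) (land : ℕ × ℕ → Finset ι → Prop),
      (∀ j ∈ J, ((E'.powerset).filter (fun ξ => fib j ξ ∧ src ξ)).card ≤ ((E'.powerset).filter (fun ξ => fib j ξ ∧ land j ξ)).card) →
      (∀ ξ, ξ ⊆ E' → src ξ → ∃ j ∈ J, fib j ξ) →
      (∀ j ∈ J, ∀ j' ∈ J, j ≠ j' → ∀ ξ, fib j ξ → fib j' ξ → False) →
      ((E'.powerset).filter (fun ξ => src ξ)).card ≤ (J.biUnion (fun j => (E'.powerset).filter (fun ξ => fib j ξ ∧ land j ξ))).card := by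
    intro J src land h cover disj
    have hsub : (E'.powerset).filter (fun ξ => src ξ) ⊆ J.biUnion (fun j => (E'.powerset).filter (fun ξ => fib j ξ ∧ src ξ)) := by
      intro ξ hξ
      rw [Finset.mem_filter, Finset.mem_powerset] at hξ
      obtain ⟨j, hj, hfib⟩ := cover ξ hξ.1 hξ.2
      exact Finset.mem_biUnion.mpr ⟨j, hj, Finset.mem_filter.mpr ⟨Finset.mem_powerset.mpr hξ.1, hfib, hξ.2⟩⟩
    have hdisj : (↑J : Set (ℕ × ℕ)).PairwiseDisjoint (fun j => (E'.powerset).filter (fun ξ => fib j ξ ∧ land j ξ)) := by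
      intro j hj j' hj' hjj'
      rw [Function.onFun, Finset.disjoint_left]
      intro ξ h1 h2
      rw [Finset.mem_filter] at h1 h2
      exact disj j hj j' hj' hjj' ξ h1.2.1 h2.2.1
    calc ((E'.powerset).filter (fun ξ => src ξ)).card
        ≤ (J.biUnion (fun j => (E'.powerset).filter (fun ξ => fib j ξ ∧ src ξ))).card := Finset.card_le_card hsub
      _ ≤ ∑ j ∈ J, ((E'.powerset).filter (fun ξ => fib j ξ ∧ src ξ)).card := Finset.card_biUnion_le
      _ ≤ ∑ j ∈ J, ((E'.powerset).filter (fun ξ => fib j ξ ∧ land j ξ)).card := Finset.sum_le_sum h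
      _ = (J.biUnion (fun j => (E'.powerset).filter (fun ξ => fib j ξ ∧ land j ξ))).card := (Finset.card_biUnion hdisj).symm
  have b₁ : ((E'.powerset).filter (fun ξ => src₁ ξ)).card ≤ Λ₁.card := bound J₁ src₁ land₁ h₁ cover₁ disj₁
  have b₂ : ((E'.powerset).filter (fun ξ => src₂ ξ)).card ≤ Λ₂.card := bound J₂ src₂ land₂ h₂ cover₂ disj₂
  -- the union of the landings are targets, the common landings are joins
  have hu : Λ₁ ∪ Λ₂ ⊆ (E'.powerset).filter (fun ξ => T₁ ξ ∨ T₂ ξ) := by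
    intro ξ hξ
    rcases Finset.mem_union.mp hξ with h | h
    · obtain ⟨j, hj, hm⟩ := Finset.mem_biUnion.mp h
      rw [Finset.mem_filter, Finset.mem_powerset] at hm
      exact Finset.mem_filter.mpr ⟨Finset.mem_powerset.mpr hm.1, Or.inl (tgt₁ j hj ξ hm.1 hm.2.1 hm.2.2)⟩
    · obtain ⟨j, hj, hm⟩ := Finset.mem_biUnion.mp h
      rw [Finset.mem_filter, Finset.mem_powerset] at hm
      exact Finset.mem_filter.mpr ⟨Finset.mem_powerset.mpr hm.1, Or.inr (tgt₂ j hj ξ hm.1 hm.2.1 hm.2.2)⟩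
  have hi : Λ₁ ∩ Λ₂ ⊆ (E'.powerset).filter (fun ξ => Jn ξ) := by
    intro ξ hξ
    obtain ⟨hm1, hm2⟩ := Finset.mem_inter.mp hξ
    obtain ⟨j, hj, hm⟩ := Finset.mem_biUnion.mp hm1
    obtain ⟨j', hj', hm'⟩ := Finset.mem_biUnion.mp hm2
    rw [Finset.mem_filter, Finset.mem_powerset] at hm hm'
    exact Finset.mem_filter.mpr ⟨Finset.mem_powerset.mpr hm.1, join ξ hm.1 j hj j' hj' hm.2.1 hm.2.2 hm'.2.1 hm'.2.2⟩
  have e := Finset.card_union_add_card_inter Λ₁ Λ₂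
  have c1 := Finset.card_le_card hu
  have c2 := Finset.card_le_card hi
  omega

end Coefficientwise

end Summit.CriticalPhenomena.PercolationContinuityZ3.Theorems
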